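import Mathlib
import HarnessLib
import HarnessLib.Audit
import Summits.Langlands.Statement
import Literature.NumberTheory.GaloisRepresentations.CyclotomicLevels
import Literature.NumberTheory.EllipticCurves.NewformGaloisRep
import Literature.NumberTheory.Automorphic.HeckeCongruenceIdeal
import Literature.NumberTheory.GaloisRepresentations.LocalGaloisGroupFrobeniusProofs
import Literature.NumberTheory.Automorphic.LocalConstantsProofs
import Literature.NumberTheory.Automorphic.LocalLanglandsGLProofs
import Literature.NumberTheory.Automorphic.ReciprocityGLnPotentialModularity
import Summits.Langlands.Langlands.Theorems.LiftDescendQuasiCharKernelOpen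
import HarnessLib.Audit.Status.Attr

/-!
Route: AdjointEulerNumerical

DORMANT since 2026-08-29T19:36:56Z (census g0: costume|duplicate of —; reader census-reader-44-g0) — unstaffed, not closed; items shared with open routes are served there. `ledger route dormant <id> --off` reactivates.

Thesis X (it suffices to show; decl `Target`): for every number field F there are reciprocity data
Rec such that for every n >= 1 (and every compactness witness hcpt) BOTH (A) `AutomorphicToGalois n
Rec hcpt` (the summit's automorphic -> Galois conjunct, carried along: every lifting engine consumes
the representations rho_pi it provides) AND the WEAK Galois -> automorphic statement hold: every
irreducible geometric rho : Gal(F̄/F) -> GL_n(Q̄_l) admits an L-algebraic cuspidal pi of GL_n(A_F)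
whose Satake parameters match charpoly rho(Frob_v) at all but finitely many v (`∀ᶠ v in cofinite,
SatakeFrobCompatibleAt ι π.1 ρ v`). One-line Lean: `∀ F, ∃ Rec : ReciprocityData F, ∀ n > 0, ∀ hcpt,
AutomorphicToGalois n Rec hcpt ∧ ∀ ℓ ι ρ, ρ.toGaloisRep.IsIrreducible → IsGeometricFramed Rec ρ → ∃
π, π.1.IsLAlgebraic ∧ ∀ᶠ v in cofinite, SatakeFrobCompatibleAt ι π.1 ρ v` (elaborates, Sketch.lean
rc 0). X -> Langlands (decl `Assembly`) is glue: (A) gives rho' corresponding to pi at every place;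
rho, rho' irreducible with equal Frobenius polynomials almost everywhere are GL_n-conjugate
(Chebotarev + Brauer–Nesbitt, tree `LAdicRepFrobenius`); `Corresponds` is frame-invariant
(`isUnramifiedAt_conj_iff`, `PstWeilDeligneData.conj`).

THE LINE (idea card euler-system-numerical-criterion, "close Wiles's 1993 loop"): prove the weak (B)
conjunct by residual automorphy + automorphy lifting, where the lifting step R = T at an automorphic
point is obtained WITHOUT Taylor–Wiles primes: the Wiles–Lenstra / de Smit–Rubin–Schoof numerical
criterion length_O(I_R/I_R^2) <= length_O(O/eta_T) (support `NumericalCriterion`, pure commutative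
algebra over Mathlib) is fed FROM ABOVE by an Euler-system bound on the adjoint Bloch–Kato Selmer
group (I_R/I_R^2)^v = H^1_f(F, ad^0 rho_pi ⊗ K/O) (crux `AdjointEulerSystem`: a cyclotomic Euler
system for ad^0 rho_pi with EXACT Euler factors, from Loeffler–Skinner–Zerbes GU(2,1) classes at
BC(Ad pi) or improved diagonal classes) and FROM BELOW by Hida's congruence ideal eta_T = L^alg(1,
Ad pi) (crux `SelmerBoundByCongruenceIdeal`). Theatres: GL_2/Q and Hilbert modular forms (defect 0;
endpoint crux `TotallyRealWeightZeroAutomorphic`), then defect 1 through the Iyengar–Khare–Manning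
codimension-l_0 criterion (endpoint crux `ImaginaryQuadraticWeightZeroAutomorphic`).

Rationale: WHY THIS LINE. Wiles's original plan (Flach 1992 doi:10.1007/BF01232029; Wiles 1995
doi:10.2307/2118559): minimal R = T from an Euler-system bound on H^1_f(Q, ad^0 rho) plus the
numerical criterion; abandoned for lack of a full Euler system and replaced by Taylor–Wiles patching
(TaylorWiles1995Annals). Since 2014 Euler systems exist next door — Sym^2 f ⊗ psi with psi != 1
"absolutely essential" (Loeffler–Zerbes arXiv:1512.03678 §1), GU(2,1) (Loeffler–Skinner–Zerbes
arXiv:2010.10946; Manji doi:10.1093/qmath/haae070), adjoint classes over Hilbert fields built FROM R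
= T (Urban arXiv:2102.06305) — and the numerical criterion now exists in codimension l_0 (IKM
arXiv:2206.08212; IKMU arXiv:2311.13070). The converse R = T => adjoint Bloch–Kato is a theorem
(Diamond–Flach–Guo doi:10.1016/j.ansens.2004.09.001; Hida 2000 §5.3.3 p. 330). Imported areas:
Iwasawa theory / Euler and Kolyvagin systems (Rubin2000, MazurRubin2004) and the commutative algebra
of congruence modules (de Smit–Rubin–Schoof Criterion I, CSS 1997 doi:10.1007/978-1-4612-1974-3 p.
413; Diamond 1997 doi:10.1007/s002220050144).
RE-ASSESSMENT OF THE CARD (refuter-facing). The Euler-system engine for T = ad^0 rho needs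
ad^0(rhobar) absolutely irreducible plus an element of Gal(F̄/F(mu_p^∞)) with distinct eigenvalues
(Rubin2000 §2.1–2.2; MazurRubin2004 §3.5); Taylor–Wiles needs rhobar|G_{F(zeta_p)} absolutely
irreducible (+ the p = 5 exception). For GL_2 the loci differ only in (i) residually DIHEDRAL rhobar
from the quadratic subfield of F(zeta_p): TW-bad AND ES-bad (ad^0 rhobar reducible) — the card's
"small or dihedral residual image" claim is wrong as stated; (ii) p = 5, projective image
PGL_2(F_5), zeta_5 in the projective kernel field: ES-good, TW-bad, but CLOSED in weight 2 by
Khare–Thorne (arXiv:1503.03796 Thm 1.1) and never met by elliptic curves (FLS arXiv:1310.7088 p. 8).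
So in defect zero the engine is a second proof architecture for known R = T; new theorems can come
only from (a) residually Borel/dihedral loci via devissage of Sel(ad^0) into character Selmer groups
bounded by classical Euler systems (prototype Skinner–Wiles 1997 doi:10.1073/pnas.94.20.10520:
numerical-criterion R = T with eta from Mazur–Wiles) — exactly where modularity of elliptic curves
over totally real fields is stuck (FLS Thm 5, 27 curves X(u,v,w); Box doi:10.1090/tran/8557; DNS
doi:10.2140/ant.2020.14.1791); (b) positive defect, where IKM print "patching is a necessary
prelude" (arXiv:2206.08212 p. 10) and the bet is an Euler-system-fed augmentation.
RANKED CRUXES (details in the items; both rank-2 engine cruxes were refuted-MISSTATED by refuter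
rattack on 2026-08-16 and repaired the same day by two route-repair planners). rank 2
`AdjointEulerSystem` [TYPED, stmt-Langlands-14257; replaces stmt-Langlands-2194: classes RELAXED at
p (no Bloch–Kato condition on them), NO Hida-period L-value]: for every newform f of weight n+2, p ∤
2N, O ⊇ Z_p a finite DVR, rho = rho_{f,iota} over O and every residually absolutely irreducible
O-lattice frame T of ad^0(rho)(1) (typed intrinsically by charpoly identities + Brauer–Nesbitt), a
Rubin Euler system over Q(mu_{p^k r}) with the EXACT cubic factors P(Fr^-1 | T*; X) = det(1 - Fr^-1
X | ad^0 rho_f) (intrinsic to `IsEulerSystem`: an extra degenerate factor is not even expressible)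
and NON-TORSION bottom class — the Loeffler–Zerbes psi = 1 problem = rank-one Perrin-Riou/Kato
zeta-element existence for Ad^0(f)(1). rank 2 `SigmaSelmerBoundByCongruenceIdeal` [informal,
stmt-Langlands-14534; replaces stmt-Langlands-2208 after the BKM 805b1/p=3/q=7 witness against
level-N congruence ideals]: Diamond–Flach–Guo Sigma-form — for rhobar absolutely irreducible, p ∤
2N, Sigma ∌ p with rho minimally ramified outside Sigma: length_O H^1_Sigma(Q, ad^0 rho ⊗ K/O) <=
v(eta_Sigma(f)), eta_Sigma(f) the congruence ideal of the fixed-determinant TRACE Hecke algebra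
T_Sigma; known for p > k TW-good (DFG Thm 3.7), open for p <= k and TW-bad dihedral; typable slices:
ordinary (Greenberg condition) and Fontaine–Laffaille. rank 3 `AdjointBottomClassIndex` [informal,
stmt-Langlands-14597; clause (iv) of the refuter's repaired C′ for 2194; waits for definition
`blochKatoFiniteSubgroupCompact` = H^1_f(Q_p, T) of a lattice in a crystalline representation]: such
an Euler system with ind_O(loc_p^s c_Q) <= v(eta_Sigma(f)) for every Sigma ∌ p containing Sigma_f —
the SAME eta_Sigma(f) as rank 2bis, so that (informally) AdjointEulerSystem +
AdjointBottomClassIndex => SigmaSelmerBoundByCongruenceIdeal by Rubin2000 Thm 2.2.3 / MazurRubin2004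
§5.2 + the rank-one Poitou–Tate step + DFG Lemma 2.1; this is the explicit-reciprocity-law half
(Kato Thm 12.5 pattern), eta-normalised, no period. rank 3 `TotallyRealWeightZeroAutomorphic`
[typed]: all elliptic curves over all totally real fields automorphic of weight zero. rank 4
`ImaginaryQuadraticWeightZeroAutomorphic` [typed]: all non-CM elliptic curves over all imaginary
quadratic fields (l_0 = 1; Caraiani–Newton arXiv:2301.10509 partial). Support rank 9
`NumericalCriterion` [typed, provable now over Mathlib]; rank 9 `QuasiCharKernelOpen` [audit alias].
KILL CRITERIA. (1) A certified p-power mismatch length H^1_Sigma(Q, ad^0 rho_f ⊗ K/O) >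
v(eta_Sigma(f)) (a positive Wiles defect for the TRACE algebra of type Sigma) at a good prime for a
small-level newform kills SigmaSelmerBoundByCongruenceIdeal and AdjointBottomClassIndex together,
and with them the engine. (2) A proof that every GU(2,1)/diagonal-cycle Euler system for ad^0 rho_f
over Q(mu_p^∞) keeps the extra degree-one factor at psi = 1 (so that no `IsEulerSystem` for T = ad^0
rho(1) with non-torsion bottom class arises from them) kills AdjointEulerSystem as a programme (the
typed statement itself is conjecturally true — Perrin-Riou/Kato — and is REFUTED only by a junk
construction, which refuters should attempt); the route then survives only as the devissage variant
(a). (3) Unbounded devissage error terms in residually dihedral families => close the defect-zero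
theatre as "second proof only".
NOT DECOMPOSED YET. Hilbert-modular Euler system (GU(2,1) over F; Dimitrov freeness, p unramified,
doi:10.1016/j.ansens.2005.03.005); the period comparison Petersson vs unitary; non-minimal level via
Ihara (Manning–Shotton) — all below the two engine cruxes via `--supports`; KT-exceptional locus in
weights 3–4; U(n) adequacy failures (no adjoint Euler system proposed); any split of Target by n or
field. The engine cruxes are NOT split further: AdjointBottomClassIndex is the only foreseen second
layer of AdjointEulerSystem (existence of classes vs. explicit reciprocity law, as in Kato 2004
§§8–13 vs Thm 12.5).
CHEAPEST FALSIFIER. For the typed rank-2 crux: exhibit a JUNK Euler system — a family c with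
`IsEulerSystem (cyclotomicLevelsRat p {v | N}) T p c` and non-torsion bottom class built from
restriction/corestriction bookkeeping alone (refuter rattack checked that the obvious candidates
fail: the zero family has torsion bottom class, p^j·c presupposes a genuine c, restriction families
break cores_p, Cor∘Res = l - 1 is not invertible at l ≡ 1 mod p); or show the hypotheses vacuous
(they are not: (11a, p = 7), (Delta, p = 11..19) have ad^0 rhobar absolutely irreducible). For the
line as a whole: the numeric Selmer-vs-eta test of kill criterion (1) at f = 11a, 37a, 805b1, p = 3,
5, 7 in the Sigma-form.
DEFINITION REQUESTS. `blochKatoFiniteSubgroupCompact` (filed 2026-08-16, topic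
Literature/NumberTheory/GaloisRepresentations): H^1_f(K_v, T) ⊆ H^1(K_v, T) for v | p and T a
lattice in a crystalline representation (BK 1990 (3.7.2)-(3.7.3); Rubin2000 Def. 1.3.4), its
singular quotient H^1_s and ind_O; period rings being abstract data in this tree, acceptable
surrogates are Fontaine–Laffaille (p - 1 > weight span; BK Lemma 4.4-4.5, DFG §1-2), Greenberg for
ordinary V (Flach 1990), or local Tate duality with the crystalline deformation condition
(CrystallineDeformationRing.lean). Wanted by AdjointBottomClassIndex (stmt-Langlands-14597) and by
the eventual signature of SigmaSelmerBoundByCongruenceIdeal (stmt-Langlands-14534), which moreover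
needs the trace Hecke algebra T_Sigma and ad^0 rho ⊗ K/O as a `BlochKatoDatum` (requested by planner
65f2f8d4).

Novelty: Nearest prior art (searched and read): Flach 1992 doi:10.1007/BF01232029 and Wiles 1995
doi:10.2307/2118559 (the original Euler-system + numerical-criterion plan, minimal case left open);
Diamond–Flach–Guo 2004 doi:10.1016/j.ansens.2004.09.001 and Hida 2000 §5.3.3 (the converse R = T =>
#Sel(ad) = congruence number, read p. 330); Loeffler–Zerbes arXiv:1512.03678 (Sym^2 x psi Euler
system, psi != 1 essential); Loeffler–Skinner–Zerbes arXiv:2010.10946 and Manji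
doi:10.1093/qmath/haae070 (GU(2,1) classes); Urban arXiv:2102.06305 (adjoint Euler systems over
Hilbert fields built FROM R = T); Iyengar–Khare–Manning arXiv:2206.08212 (numerical criterion in
codimension l_0, read p. 10: "patching is a necessary prelude"); Khare–Thorne arXiv:1503.03796 Thm
1.1 (the only GL_2 Taylor–Wiles-bad / Euler-system-good residual locus, already closed in weight 2);
Skinner–Wiles 1997 doi:10.1073/pnas.94.20.10520 (numerical-criterion R = T fed by Mazur–Wiles in the
residually reducible ordinary case). Searches: zbMATH/crossref "Euler system adjoint numerical
criterion", "residually S5 automorphy", "totally real quartic modular", "Caraiani Newton imaginary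
quadratic"; local index unavailable this session. DELTA: a new combination — 2020s adjoint-adjacent
Euler systems (GU(2,1) at BC(Ad f), improved diagonal classes) + Hida's congruence ideal + de
Smit–Rubin–Schoof Criterion I as a Taylor–Wiles-prime-free R = T engine, with two corrections to the
card recorded in the rationale (dihedral loci are NOT  [refs: 10.1007/BF01232029, 10.2307/2118559, 10.1016/j.ansens.2004.09.001, 10.1093/qmath/haae070, 10.1073/pnas.94.20.10520, 1512.03678, 2010.10946, 2102.06305, 2206.08212, 1503.03796, doi:10.1007/BF01232029, doi:10.2307/2118559, doi:10.1016/j.ansens.2004.09.001, doi:10.1093/qmath/haae070, doi:10.1073/pnas.94.20.10520]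

Barriers (technique_class: euler-systems numerical-criterion automorphy-lifting): technique_class: euler-systems numerical-criterion automorphy-lifting
- Literature.Barriers.Langlands.TaylorWilesNumericalCoincidence: evaded in defect zero only in the
weak sense that no Taylor–Wiles primes and no numerical count of auxiliary primes occur (the
criterion is length(I_R/I_R^2) <= length(O/eta)); NOT evaded in positive defect: crux
ImaginaryQuadraticWeightZeroAutomorphic rests on the Iyengar–Khare–Manning codimension-l_0
criterion, for which the printed position is that patching is a necessary prelude (arXiv:2206.08212
p. 10); the bet is an Euler-system-fed augmentation.
- Literature.Barriers.Langlands.TaylorWilesNumericalCoincidenceNarrow: same; the GL_2 theatres of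
this route (F totally real: defect 0; F imaginary quadratic: defect 1) sit exactly on the two sides
of the narrow barrier, and the route does not claim the non-polarizable n >= 3 cases.
- Literature.Barriers.Langlands.ResiduallyReducibleBarrier: NOT evaded by the adjoint Euler system
itself (it needs ad^0(rhobar) absolutely irreducible, which fails for reducible AND for all dihedral
rhobar — recorded correction to the card); the route's only handle there is the devissage variant
(character Selmer groups bounded by cyclotomic-unit / elliptic-unit / Stickelberger Euler systems,
prototype Skinner–Wiles 1997), filed inside crux TotallyRealWeightZeroAutomorphic's why-might-fail,
not as a separate claim.
- Literature.Barriers.Langlands.PatchingLocalComponentBarrier: evaded at minimal level and in the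
Font

History (route lifecycle, newest last):
- 2026-08-16T03:49:48Z · AUTO-CRUX (edit): Target — hypotheses of the deciding theorem that nothing in the route derives are cruxes (planner-rrefute-Langlands-AdjointEulerNumerica-65f2f8d4-0)
- 2026-08-16T03:55:49Z · rev 12: dropped stmt-Langlands-14544 — route-repair (planner 73f15211): drop my own stmt-Langlands-14544 AdjointBottomClassIndex (filed 40 min ago, informal) to re-file it with the normaliser aligned (planner-rrefute-Langlands-AdjointEulerNumerica-73f15211-0)
- 2026-08-16T03:57:21Z · rev 13: dropped stmt-Langlands-14544 — route-repair (planner 73f15211): drop my own stmt-Langlands-14544 AdjointBottomClassIndex (filed 40 min ago, informal) to re-file it with the normaliser aligned (planner-rrefute-Langlands-AdjointEulerNumerica-73f15211-0)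
- 2026-08-16T03:58:50Z · rev 14: dropped stmt-Langlands-14544 — route-repair (planner 73f15211): drop my own stmt-Langlands-14544 AdjointBottomClassIndex (filed 40 min ago, informal) to re-file it with the normaliser aligned (planner-rrefute-Langlands-AdjointEulerNumerica-73f15211-0)
- 2026-08-16T04:00:28Z · rev 15: dropped stmt-Langlands-14544 — route-repair (planner 73f15211): drop my own stmt-Langlands-14544 AdjointBottomClassIndex (filed 40 min ago, informal) to re-file it with the normaliser aligned (planner-rrefute-Langlands-AdjointEulerNumerica-73f15211-0)
- 2026-08-24T21:51:01Z · DORMANT — reconciler: no traction for 7.1 d (last activity statement-claimed at 2026-08-17T18:51:59Z); parked, not closed — `ledger route dormant route-Langlands-AdjointE (operator:999:1412455)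
- 2026-08-28T21:07:53Z · REACTIVATED — reconciler: reactivated — activity statement-checked at 2026-08-28T19:08:39Z after parking at 2026-08-24T21:51:01Z (operator:999:1668025)
- 2026-08-29T19:36:56Z · DORMANT — census g0: costume|duplicate of —; reader census-reader-44-g0 (operator:999:1419420)

sub-problem: Langlands · status: dormant · opened planner-plancard-Langlands-Langlands-euler-sy-bf26b3f1-0 2026-08-15T11:01:31Z · rev 17 · ledger route-Langlands-AdjointEulerNumerical
GENERATED by the gate from the ledger (D-0016/17). Provers cite these decls: `theorem foo : Summit.Langlands.Langlands.Theses.AdjointEulerNumerical.<Decl> := …` in Summits/Langlands/Langlands/Theorems/<Name>.lean.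
-/

namespace Summit.Langlands.Langlands.Theses.AdjointEulerNumerical

open scoped BigOperators Topology Manifold Classical MeasureTheory ProbabilityTheory Matrix InnerProductSpace ComplexConjugate ContinuousMap
open Filter Set Function TopologicalSpace MeasureTheory

attribute [summit_statement] _root_.Langlands

/-- item stmt-Langlands-2174 · crux (kind.auto-crux: conjecture-grade) · rank 0 · open · by planner
why it might fail: X = the summit with (B) weakened to almost-everywhere Satake matching, (A) carried along: false iff GL_n reciprocity fails for some (F,n). No engine exists for n>=3 non-polarizable rho, for F not totally real/CM, or for irregular weight; the weak (B) half is open even for n=2 over totally real F.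
sources: BuzzardGeeLMS2014, Conj. 3.2.1-3.2.2, FontaineMazurGeometric1995, Conj. 1, Calegari2023, §9-10 (state of the art of (B)), CalegariGeraghty2017, §1, arXiv:2206.08212, §1 (positive defect)
[target] Thesis X of route AdjointEulerNumerical: for every number field F there is ONE reciprocity
datum Rec (as in `Langlands`) such that for all n >= 1: (A) `AutomorphicToGalois n Rec hcpt` AND
weak (B): every irreducible geometric rho : Gal(F̄/F) -> GL_n(Q̄_l) has an L-algebraic cuspidal pi
of GL_n(A_F) with `SatakeFrobCompatibleAt ι π.1 ρ v` for cofinitely many v. (A) is imported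
(automorphic -> Galois routes own it; lifting engines consume rho_pi); this route attacks the weak
(B) conjunct through residual automorphy + Taylor-Wiles-prime-free automorphy lifting (see Assembly
and the cruxes). The single ∃ Rec is deliberate: an `∀ Rec, (A) -> weak (B)` form would be exposed
to junk p-adic Hodge data making `IsGeometricFramed` too permissive. Sketch.lean (planner folder)
lean check rc 0, 2026-08-15. -/
@[route_item "route-Langlands-AdjointEulerNumerical", crux]
def Target : Prop :=
  ∀ (F : Type) [Field F] [NumberField F], ∃ Rec : ReciprocityData F, ∀ n : ℕ, 0 < n → ∀ hcpt : Literature.NumberTheory.Automorphic.isCompact_glFiniteIntegralLevel n F, AutomorphicToGalois n Rec hcpt ∧ ∀ (ℓ : ℕ) [Fact ℓ.Prime] (ι : PadicAlgCl ℓ ≃+* ℂ) (ρ : Literature.NumberTheory.GaloisRepresentations.FramedGaloisRep F (PadicAlgCl ℓ) n), ρ.toGaloisRep.IsIrreducible → IsGeometricFramed Rec ρ → ∃ π : Literature.NumberTheory.Automorphic.CuspidalAutomorphicRepData n F hcpt, π.1.IsLAlgebraic ∧ ∀ᶠ v in cofinite, SatakeFrobCompatibleAt ι π.1 ρ v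

-- earlier AdjointEulerSystem (stmt-Langlands-2194, replaced 2026-08-16T03:12:29Z -> stmt-Langlands-14257): retired by None — [crux] (rank 2 — the heart of the line; informal until the definition `CyclotomicEulerSystem` lands, then set-signature.) ADJOINT EULER SYSTEM WITH EXACT EULER FACTORS, GL_2/Q first: for every newform f in S_k(Gamma_1(N)), k >= 2, every prime p not dividing 2N at which ad^0(rh
/-- item stmt-Langlands-14257 · crux · rank 2 · open · by planner
why it might fail: At ψ = 1 every known construction (Beilinson–Flach, GU(2,1) descent, diagonal cycles) keeps an extra vanishing degree-1 Euler factor or a torsion bottom class: LZ arXiv:1512.03678 §1.2 'ψ ≠ 1 absolutely essential'; Flach 1992 only an annihilator; nothing with exact P_ℓ for ad⁰ in print (2026).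
sources: arXiv:1512.03678, §1.2 (Loeffler–Zerbes: ψ ≠ 1 'absolutely essential'; P_ℓ is the 4-dim tensor factor), arXiv:2010.10946 (Loeffler–Skinner–Zerbes, GU(2,1) Euler system), doi:10.1093/qmath/haae070 (Manji 2025, GU(2,1) Selmer bounds), doi:10.1007/BF01232029 (Flach 1992, fragment of an Euler system), arXiv:2607.12679, Thm A (Kundu–Ray–Vigni 2026: Sym² Hida family, still ψ-twisted), arXiv:2102.06305, Thms 1–3 (Urban: adjoint classes FROM R = T — excluded input)
[crux] (rank 2 — the heart of the line; REPAIRED 2026-08-16 after refuter rattack's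
refuted-misstated verdict on the original informal text, EVIDENCE.md §C′ of stmt-Langlands-2194:
(M1) NO local condition on the classes at p — Euler-system classes are relaxed at p, 'Bloch–Kato
finite at p' is the condition of the DUAL Selmer group they bound; (M2) NO Hida-period L-value in
the statement — the link to L(1, Ad f) goes through the congruence ideal η_f and lives in the
separate crux AdjointBottomClassIndex.) ADJOINT EULER SYSTEM WITH EXACT EULER FACTORS, GL₂/ℚ: for
every newform f ∈ S_{n+2}(Γ₁(N)) (n ≥ 0), every prime p ∤ 2N, every O = DVR, module-finite
ℤ_p-algebra with its module topology, every ι : 𝓞_f → O, every ρ : Γ_ℚ → GL₂(O) attached to f via ι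
away from Np (`IsGaloisRepOfNewform1Int`), and every T : Γ_ℚ → GL₃(O) which is (a frame of) an
O-lattice in ad⁰(ρ)(1) — typed INTRINSICALLY: charpoly T(σ) = (X − χ(σ))·(X² − χ(σ)(tr ρ(σ)²/det
ρ(σ) − 2)·X + χ(σ)²) for ALL σ ∈ Γ_ℚ, χ the p-adic cyclotomic character
(`cyclotomicCharacterToUnits`) — and RESIDUALLY ABSOLUTELY IRREDUCIBLE (T ⊗_g B irreducible for
every field B of characteristic p and every g : O → B; ⟺ ad⁰(ρ̄_{f,ι}) absolutely -/
@[route_item "route-Langlands-AdjointEulerNumerical"]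
def AdjointEulerSystem : Prop :=
  ∀ (N : ℕ) [NeZero N] (n : ℕ) (f : CuspForm (CongruenceSubgroup.Gamma1 N) (n + 2)), Literature.NumberTheory.EllipticCurves.ModularForms.IsNewform1 f → ∀ (p : ℕ) [Fact p.Prime], ¬ p ∣ 2 * N → ∀ (O : Type) [CommRing O] [IsDomain O] [IsDiscreteValuationRing O] [Algebra ℤ_[p] O] [Module.Finite ℤ_[p] O] [TopologicalSpace O] [IsTopologicalRing O] [IsModuleTopology ℤ_[p] O] (ι : Literature.NumberTheory.EllipticCurves.ModularForms.coeffCharIntegers f →+* O) (ρ : Literature.NumberTheory.GaloisRepresentations.FramedGaloisRep ℚ O 2), Literature.NumberTheory.EllipticCurves.ModularForms.IsGaloisRepOfNewform1Int f ι {ℓ | ℓ ∣ N * p} ρ → ∀ (T : Literature.NumberTheory.GaloisRepresentations.FramedGaloisRep ℚ O 3), (∀ σ : Field.absoluteGaloisGroup ℚ, Literature.NumberTheory.GaloisRepresentations.FramedRep.charpoly T σ = (Polynomial.X - Polynomial.C (((Literature.NumberTheory.GaloisRepresentations.cyclotomicCharacterToUnits ℚ p O σ : Oˣ) : O))) * (Polynomial.X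 ^ 2 - Polynomial.C ((((Literature.NumberTheory.GaloisRepresentations.cyclotomicCharacterToUnits ℚ p O σ : Oˣ) : O)) * ((Literature.NumberTheory.GaloisRepresentations.FramedRep.trace ρ σ) ^ 2 * (((Matrix.GeneralLinearGroup.det (ρ σ))⁻¹ : Oˣ) : O) - 2)) * Polynomial.X + Polynomial.C ((((Literature.NumberTheory.GaloisRepresentations.cyclotomicCharacterToUnits ℚ p O σ : Oˣ) : O)) ^ 2))) → (∀ (B : Type) [Field B] [CharP B p] (g : O →+* B), (Literature.NumberTheory.GaloisRepresentations.FramedRep.baseChangeRepresentation g T).IsIrreducible) → ∃ (c : ∀ (k : ℕ) (r : (Literature.NumberTheory.GaloisRepresentations.cyclotomicLevelsRat p {v : IsDedekindDomain.HeightOneSpectrum (NumberField.RingOfIntegers ℚ) | ((Rat.HeightOneSpectrum.primesEquiv v : Nat.Primes) : ℕ) ∣ N}).Ideals), Literature.NumberTheory.GaloisRepresentations.H1 T.toGaloisRep ((Literature.NumberTheory.GaloisRepresentations.cyclotomicLevelsRat p {v : IsDedekindDomain.HeightOneSpectrum (NumberField.RingOfIntegers ℚ) | ((Rat.HeightOneSpectrum.primesEquiv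 v : Nat.Primes) : ℕ) ∣ N}).level k r.1)) (hc : Literature.NumberTheory.GaloisRepresentations.IsEulerSystem (Literature.NumberTheory.GaloisRepresentations.cyclotomicLevelsRat p {v : IsDedekindDomain.HeightOneSpectrum (NumberField.RingOfIntegers ℚ) | ((Rat.HeightOneSpectrum.primesEquiv v : Nat.Primes) : ℕ) ∣ N}) T.toGaloisRep p c), ∀ a : O, a • hc.bottomClass = 0 → a = 0

-- item stmt-Langlands-14534 · crux · rank 2 · open · by planner — informal only, no Lean statement yet:
--   [crux] (rank 2bis · REPAIRED 2026-08-16 after refuter rattack's refuted-misstated verdict,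
--   evidence-2208.md: witness f = 805b1, p = 3, level-raising prime q = 7 — with η in the Hecke algebra
--   at the level of a NON-minimally-ramified f and Selmer conditions 'minimal relative to f' the bound
--   fails by Σ_q(2n_q − m_q) = 1, Böckle–Khare–Manning arXiv:1910.08507 Thm 10.1 + Prop 9.1 + Thm 6.3.
--   REPAIR = Diamond–Flach–Guo's Σ-form: Selmer conditions AND Hecke algebra both of type Σ with f
--   minimally ramified outside Σ; fixed determinant (ad⁰, not ad); TRACE Hecke algebra.) SELMER LENGTH ≤
--   CONGRUENCE IDEA

-- item stmt-Langlands-14597 · crux · rank 3 · open · by planner — informal only, no Lean statement yet: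
--   [crux] (rank 3 — clause (iv) of the refuter's repaired C′ for AdjointEulerSystem, split off
--   2026-08-16 by the route-repair planner and re-normalised by η_Σ(f) (Σ-form, matching
--   stmt-Langlands-14534) the same day; INFORMAL until the definition `blochKatoFiniteSubgroupCompact` —
--   Bloch–Kato H¹_f(ℚ_p, T) of a LATTICE in a crystalline representation, with H¹_s := H¹/H¹_f — lands,
--   then set-signature.) ADJOINT BOTTOM-CLASS INDEX ≤ CONGRUENCE IDEAL: in the setting of
--   `AdjointEulerSystem` (newform f ∈ S_{n+2}(Γ₁(N)); p ∤ 2N; O ⊇ ℤ_p a finite DVR; ι : 𝓞_f → O; ρ : Γ_ℚ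
--   → GL₂(O) attached to f via ι; T any

/-- item stmt-Langlands-2176 · crux · rank 3 · open · by planner
why it might fail: Open exactly on FLS's 27 residual loci X(u,v,w) (rhobar_{E,p}(G_{F(zeta_p)}) abs. reducible for p=3,5,7 at once): there ad^0 rhobar is reducible, so NEITHER Taylor-Wiles NOR the adjoint Euler system applies; only a devissage to character Euler systems (Skinner-Wiles 1997 type, ordinary) remains.
sources: arXiv:1310.7088, Thms 1, 3-5 and p. 8 (Freitas-Le Hung-Siksek 2015), doi:10.2140/ant.2020.14.1791 (Derickx-Najman-Siksek, cubic), doi:10.1090/tran/8557 = arXiv:2103.13975 (Box, quartic without sqrt 5), doi:10.1073/pnas.94.20.10520 (Skinner-Wiles 1997, numerical criterion in the residually reducible ordinary case), Thorne2016 (residually dihedral), SkinnerWiles1999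
[crux] Defect-zero theatre endpoint: every elliptic curve over every totally real field F (integral
model E over O_F with Δ != 0) is automorphic of weight zero on the Borel-Jacquet carrier of the
summit (`IsAutomorphicOfWeightZero`: a weight-zero cuspidal pi of GL_2(A_F) with Hecke polynomial
X^2 - a_w X + q_w at every place w not dividing Δ(E)). Known: [F:Q] <= 3 (FLS arXiv:1310.7088 Thm 1;
DNS), totally real quartic F without sqrt 5 (Box), and in general all but finitely many j-invariants
per field (FLS Thm 5). THIS LINE's angle: the stuck curves are exactly those with residually Borel /
dihedral rhobar_{E,p} for p = 3, 5, 7 simultaneously; there Sel(ad^0 rho_E) devisses into Selmer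
groups of characters over F and over the CM quadratic extension cut out by rhobar, which are bounded
by classical Euler systems / proved main conjectures (cyclotomic units, Stickelberger and
Brumer-Stark over totally real F, Hsieh's CM main conjecture), and the numerical criterion needs
only length(I_R/I_R^2) <= length(O/eta) with eta from Eisenstein / CM congruences (prototype:
Skinner-Wiles PNAS 1997 over Q, ordinary, via Mazur-Wiles). CM curves: pi = automorphic induction,
cuspidal since the CM fie -/
@[route_item "route-Langlands-AdjointEulerNumerical"]
def TotallyRealWeightZeroAutomorphic : Prop :=
  ∀ (F : Type) [Field F] [NumberField F] [NumberField.IsTotallyReal F] (E : WeierstrassCurve (NumberField.RingOfIntegers F)), E.Δ ≠ 0 → Literature.NumberTheory.Automorphic.IsAutomorphicOfWeightZero E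

/-- item stmt-Langlands-2177 · crux · rank 4 · open · by planner
why it might fail: Defect l_0 = 1: R and T have torsion, the IKM criterion needs an augmentation that so far exists only at patched level ('patching is a necessary prelude', arXiv:2206.08212 p.10), and no Euler system for ad^0 rho over an imaginary quadratic field is known or proposed; residual loci as in FLS persist.
sources: arXiv:2206.08212 = doi:10.1007/s00222-024-01292-y, Thm A-F and p. 10 (Iyengar-Khare-Manning), arXiv:2311.13070 (IKM-Urban), arXiv:2301.10509 (Caraiani-Newton, partial modularity over imaginary quadratic fields), AllenCalegariCaraianiGeeEtAl2023, Thm 1.0.1 (potential modularity; tree fact potentiallyModular_ellipticCurve_CM), CalegariGeraghty2017, §1, Literature.Barriers.Langlands.TaylorWilesNumericalCoincidence (defectGL_eq_zero_iff)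
[crux] Defect-one theatre endpoint (the card's positive-defect crux): every elliptic curve WITHOUT
geometric CM over every imaginary quadratic field F (integral model, Δ != 0; `¬ (E.baseChange
F).HasCM` as in lang.S28, since for CM by an order in F itself pi would be Eisenstein) is
automorphic of weight zero (`IsAutomorphicOfWeightZero`). Known: potentially (ACC+ 2023, vendored as
`potentiallyModular_ellipticCurve_CM` / `exists_isCMField_isAutomorphicOfWeightZero`); actually for
a density-one / positive-proportion set and for many individual F (Caraiani-Newton arXiv:2301.10509
and sequels), via derived Taylor-Wiles patching (Calegari-Geraghty) plus local-global compatibility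
for torsion classes. THIS LINE's angle: Iyengar-Khare-Manning extend the Wiles-Lenstra-Diamond
numerical criterion to codimension l_0 > 0 (congruence module of the augmentation vs Wiles defect of
the patched module); the bet is that the augmentation lambda : R -> O at an automorphic point
together with an Euler-system bound on H^1_f(F, ad^0 rho ⊗ K/O) over the imaginary quadratic field
can replace the patched level. WHY IT MIGHT FAIL: see why_might_fail; in addition the relevant
Galois cohomology over F has pos -/
@[route_item "route-Langlands-AdjointEulerNumerical"]
def ImaginaryQuadraticWeightZeroAutomorphic : Prop :=
  ∀ (F : Type) [Field F] [NumberField F] [NumberField.IsCMField F], Module.finrank ℚ F = 2 → ∀ (E : WeierstrassCurve (NumberField.RingOfIntegers F)), E.Δ ≠ 0 → ¬ (E.baseChange F).HasCM → Literature.NumberTheory.Automorphic.IsAutomorphicOfWeightZero E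

/-- item stmt-Langlands-10478 · support · rank 9 · closed · proved by Summit.Langlands.Langlands.Theorems.liftDescend_quasiCharKernelOpen_proof (prover) · by planner
[support] needs-fact (route-repair g4 2026-08-15, cone guardrail; audit alias): the named fact
`Literature.NumberTheory.Automorphic.isOpen_ker_quasiChar` (quasi-characters of Fˣ have open kernel;
BushnellHenniart2006 §1.5) is a field (`hqc`) of every `LocalLanglandsDatum`, hence of every
`ReciprocityData F` the route's items quantify over. It is DISCHARGED in tree
(`isOpen_ker_quasiChar_holds`, LocalLanglandsGLProofs.lean:367, now imported by this route file) but
the gate's cone audit (`#h21_route_deps`, H21.Audit.statesExactly) does not see the witness: its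
binders are `[Field F] [ValuativeRel F] [TopologicalSpace F]` while the def's are `[Field F]
[TopologicalSpace F] [ValuativeRel F]`, so the fact still counts in deps.unproved (2 left: this and
exists_galoisRep_of_regularAlgebraic). DELIVERABLE for whoever takes this item: (1) the one-line
Literature alias, proposed into Literature/NumberTheory/Automorphic/LocalLanglandsGLProofs.lean
(namespace Literature.NumberTheory.Automorphic): `theorem isOpen_ker_quasiChar.holds {F : Type*}
[Field F] [TopologicalSpace F] [ValuativeRel F] [IsNonarchimedeanLocalField F] :
isOpen_ker_quasiChar (F := F) := isOpen_ker_quasiChar_holds` (verified -/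
@[route_item "route-Langlands-AdjointEulerNumerical"]
def QuasiCharKernelOpen : Prop :=
  ∀ (F : Type) [Field F] [TopologicalSpace F] [ValuativeRel F] [IsNonarchimedeanLocalField F], Literature.NumberTheory.Automorphic.isOpen_ker_quasiChar (F := F)

/-- `QuasiCharKernelOpen` holds: proved by `Summit.Langlands.Langlands.Theorems.liftDescend_quasiCharKernelOpen_proof`. -/
theorem QuasiCharKernelOpen_holds : QuasiCharKernelOpen := _root_.Summit.Langlands.Langlands.Theorems.liftDescend_quasiCharKernelOpen_proof

/-- item stmt-Langlands-2178 · support · rank 9 · open · by planner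
why it might fail: Known theorem (de Smit-Rubin-Schoof Criterion I / Lenstra); as typed: O complete DVR, R complete Noetherian local O-algebra, T local finite free over O, phi surjective; could only fail by a typing slip (e.g. Module.length of the cotangent module taken over O via the tower instance).
sources: doi:10.1007/978-1-4612-1974-3, de Smit-Rubin-Schoof 'Criteria for complete intersections', Criterion I (held: book:cornell1997-modular-forms-fermats-last-theorem PDF p. 413), DarmonDiamondTaylor1995, §5 (numerical criterion), doi:10.1007/s002220050144 (Diamond 1997, Thm 2.4, module version), doi:10.2307/2118559 (Wiles 1995, Appendix), arXiv:2206.08212 §1 (history; higher codimension)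
[support] The Wiles-Lenstra numerical criterion, de Smit-Rubin-Schoof Criterion I (CSS 1997, PDF p.
413), stated over Mathlib: O a complete discrete valuation ring; R a complete Noetherian local
O-algebra; T a local O-algebra, finite and free as O-module; phi : R ->_O T a surjective O-algebra
map; pi : T ->_O O an augmentation (automatically surjective); I_R := ker(pi ∘ phi), Phi_R :=
I_R/I_R^2 (`Ideal.Cotangent`, an O-module through the tower instance), eta_T := pi(Ann_T(ker pi))
(`Ideal.map π (RingHom.ker π).annihilator`). CLAIM: if length_O(O/eta_T) is finite (i.e. eta_T != 0)
and length_O(Phi_R) <= length_O(O/eta_T) then phi is bijective (DRS: then moreover equality holds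
and R, T are complete intersections; the inequality >= always holds). Proof in print: Fitting ideals
+ Tate's theorem on complete intersections via Koszul complexes (DRS §§1-3, 4 pages). Pure
commutative algebra, provable now; it is the algebraic half of the route's engine and is reusable by
every R = T route. A prover may generalise (drop completeness of R, replace DVR by 'O/eta finite
length') if the DRS proof allows. -/
@[route_item "route-Langlands-AdjointEulerNumerical"]
def NumericalCriterion : Prop :=
  ∀ (O R T : Type) [CommRing O] [IsDomain O] [IsDiscreteValuationRing O] [IsAdicComplete (IsLocalRing.maximalIdeal O) O] [CommRing R] [IsLocalRing R] [IsNoetherianRing R] [IsAdicComplete (IsLocalRing.maximalIdeal R) R] [Algebra O R] [CommRing T] [IsLocalRing T] [Algebra O T] [Module.Finite O T] [Module.Free O T] (φ : R →ₐ[O] T) (π : T →ₐ[O] O), Function.Surjective φ → Module.length O (O ⧸ Ideal.map π (RingHom.ker π).annihilator) ≠ ⊤ → Module.length O (RingHom.ker (π.comp φ)).Cotangent ≤ Module.length O (O ⧸ Ideal.map π (RingHom.ker π).annihilator) → Function.Bijective φ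

/-- item stmt-Langlands-2175 · assembly · rank 1 · open · by planner
sources: Summits/Langlands/Langlands/Statement.lean (Corresponds, IsConjugate), Literature/NumberTheory/GaloisRepresentations/LAdicRepFrobenius.lean (Chebotarev + Brauer-Nesbitt), Literature/NumberTheory/GaloisRepresentations/PstWeilDeligne.lean (PstWeilDeligneData.conj), BuzzardGeeLMS2014, Conj. 3.2.2
[assembly] Target -> Langlands. GLUE, provable with tree facts as hypotheses where needed: fix F,
take Rec from Target; (A) is the first conjunct verbatim. For (B): given rho irreducible and
Rec-geometric, weak (B) gives pi L-algebraic cuspidal with Satake matching a.e.; (A) applied to pi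
gives rho' irreducible geometric with `Corresponds Rec ι π.1 ρ'`; rho and rho' have equal Frobenius
characteristic polynomials at cofinitely many v (both match the same Satake parameters;
`hasSatakeParamAt` is unique), hence are GL_n(Q̄_l)-conjugate by Chebotarev density + Brauer-Nesbitt
for irreducible l-adic representations (tree: `LAdicRepFrobenius`,
`ReciprocityGLnGaloisConjProofs`); finally `Corresponds Rec ι π.1` is invariant under
`FramedRep.conj g` (Satake clause: `isUnramifiedAt_conj_iff` + charpoly conjugation-invariance;
local-global clause: `PstWeilDeligneData.conj`, conjugation of the Weil-Deligne datum r in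
`IsWeilDeligneOfLadic`, `IsTransportAlong`, `HasFrobSemisimpleClass` is a class function). If a
needed invariance of an accepted predicate is not provable as stated, file it as a support lemma
with `--supports Assembly` rather than weakening Target. -/
@[route_item "route-Langlands-AdjointEulerNumerical", crux]
def Assembly : Prop :=
  Target → _root_.Langlands

/-! D-0027 §2.1 — DECIDING THEOREM (planner-authored via `route open/edit --closes-file`; by planner-rbadge-Langlands-AdjointEulerNumerical-5019d21d-g4-0 2026-08-15T16:17:19Z):
its hypotheses are this route's items and its conclusion the sub-problem Statement (glue_lint), and it elaborates with this file. -/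

@[closes "route-Langlands-AdjointEulerNumerical"] theorem closes (hT : Target) (hA : Assembly) : _root_.Langlands := hA hT

end Summit.Langlands.Langlands.Theses.AdjointEulerNumerical
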